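import Mathlib.Combinatorics.SimpleGraph.Connectivity.Connected
import Mathlib.Combinatorics.SimpleGraph.Maps
import Mathlib.Data.ZMod.Defs
import Mathlib.Algebra.Group.Pi.Basic
import Mathlib.Data.Fintype.Card
import Mathlib.Data.Fintype.Sum
import Mathlib.Data.Fintype.Prod
import Mathlib.Tactic.Ring
import HarnessLib

/-!
# Crux `Capture` (stmt-PneNP-2659) — the UNBALANCED-CYCLE door is ONE GRANK gate: definitions

Objects of the positive one-gate theorems `unbalanced_isGRankGate` / `signedSpan_isGRankGate` /
`nonBipartite_isGRankGate` (`ConvexRankGatesCaptureSignedGate.lean`, lead c10). Data: a finite vertex type `V`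
and a SIGNED edge list `(p i, q i)` with sign bit `o i`, `i : Fin n` (the gate inputs; Harary 1953). The door is
the monotone Boolean function

  `v ↦ [the selected signed subgraph is unbalanced]`
  `= [∃ a, (a,0) ~ (a,1) in the signed double cover]`                       (`Unbalanced`, `cover`)
  `= [(1, 0) ∈ span_{𝔽₂} {(o_i ; e_{p_i} + e_{q_i}) : v_i = 1}]`            (`col`; `…SignedCover`)
  `= [the selected subgraph is not 2-colourable]` when all signs are odd    (`selGraph`; `…SignedCover`),

i.e. the PORT at the sign element of a signed-graphic (even-cycle) binary matroid — the case "`M / t` graphic" of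
the disprover's one-gate question PQ (abelian PERM ⊆ one GRANK gate?), dual to lead c8's T-join case "`M ∖ t`
graphic". It is realised as the perfect-matching function of a wire-controlled gadget (`gadget`: vertices `GV V`,
constant cells `cell₀`, wire cells `cellW`; `finGadget`/`gadgetIso` relabel it on `Fin d`, `d = 4|V|² + 2`,
in the literal shape of the tree's TUTTE gates), hence ONE GRANK gate by `isGRankGate_of_tutteGate`.
This file only fixes the vocabulary and its unfolding lemmas; `cover_adj` is the registered anchor.
Sources: F. Harary, Michigan Math. J. 2 (1953) 143–146; T. Zaslavsky, Discrete Appl. Math. 4 (1982) 47–74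
(signed covering graph); W. T. Tutte, J. London Math. Soc. 22 (1947). [folklore]
-/

namespace Summit.PneNP.PneNP.Theorems.Capture.Signed

set_option linter.dupNamespace false -- `Summit.PneNP.PneNP.…`: summit = sub-problem (D-0017)

open SimpleGraph

variable {V : Type} {n : ℕ}

/-! ### The signed double cover and the door -/

/-- The **signed double cover** of the selected signed subgraph: vertex set `V × Bool`; every selected wire `i`
(an edge `p_i q_i` of sign `o_i`) contributes the edges `(p_i, c) — (q_i, c ⊕ o_i)`, `c ∈ {0,1}` (Zaslavsky's signed
covering graph). [folklore] -/
def cover (p q : Fin n → V) (o : Fin n → Bool) (v : Fin n → Bool) : SimpleGraph (V × Bool) :=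
  SimpleGraph.fromRel fun a b => ∃ i, v i = true ∧ a.1 = p i ∧ b.1 = q i ∧ b.2 = (a.2 ^^ o i)

/-- The door's acceptance condition: the selected signed subgraph is **unbalanced** — some vertex has its two
lifts connected in the signed double cover (equivalently: it contains a closed walk with an odd number of odd
edges). [folklore] -/
def Unbalanced (p q : Fin n → V) (o : Fin n → Bool) (v : Fin n → Bool) : Prop :=
  ∃ a : V, (cover p q o v).Reachable (a, false) (a, true)

/-- The symmetric one-wire relation on cover nodes: `z — z'` is one of the two lifts of wire `i`. [folklore] -/
def Drel (p q : Fin n → V) (o : Fin n → Bool) (i : Fin n) (z z' : V × Bool) : Prop :=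
  (z.1 = p i ∧ z'.1 = q i ∧ z'.2 = (z.2 ^^ o i)) ∨ (z'.1 = p i ∧ z.1 = q i ∧ z.2 = (z'.2 ^^ o i))

/-- The column of wire `i`: `(o_i ; e_{p_i} + e_{q_i}) ∈ 𝔽₂ × 𝔽₂^V`. [folklore] -/
def col [DecidableEq V] (p q : Fin n → V) (o : Fin n → Bool) (i : Fin n) : ZMod 2 × (V → ZMod 2) :=
  ((if o i then 1 else 0), Pi.single (p i) 1 + Pi.single (q i) 1)

/-- The (unsigned) selected subgraph on `V`: edge `p_i q_i` for every selected wire `i`. [folklore] -/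
def selGraph (p q : Fin n → V) (v : Fin n → Bool) : SimpleGraph V :=
  SimpleGraph.fromRel fun a b => ∃ i, v i = true ∧ a = p i ∧ b = q i

variable {p q : Fin n → V} {o : Fin n → Bool}

/-- **Adjacency in the signed double cover, unfolded** (registered anchor `cover_adj`). [folklore] -/
theorem cover_adj : ∀ {V : Type} {n : ℕ} {p q : Fin n → V} {o : Fin n → Bool} {v : Fin n → Bool} {a b : V × Bool},
    (cover p q o v).Adj a b ↔ a ≠ b ∧
      ((∃ i, v i = true ∧ a.1 = p i ∧ b.1 = q i ∧ b.2 = (a.2 ^^ o i)) ∨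
        (∃ i, v i = true ∧ b.1 = p i ∧ a.1 = q i ∧ a.2 = (b.2 ^^ o i))) := by
  intros
  simp only [cover, fromRel_adj]

/-- Cover adjacency through `Drel`. [folklore] -/
theorem cover_adj_iff_drel {v : Fin n → Bool} {z z' : V × Bool} :
    (cover p q o v).Adj z z' ↔ z ≠ z' ∧ ∃ i, v i = true ∧ Drel p q o i z z' := by
  rw [cover_adj]
  simp only [Drel, and_or_left, exists_or]

/-- Unbalanced selection through `Drel`: adjacency of the selected subgraph `selGraph`, unfolded. [folklore] -/
theorem selGraph_adj {v : Fin n → Bool} {a b : V} :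
    (selGraph p q v).Adj a b ↔ a ≠ b ∧
      ((∃ i, v i = true ∧ a = p i ∧ b = q i) ∨ (∃ i, v i = true ∧ b = p i ∧ a = q i)) := by
  simp only [selGraph, fromRel_adj]

/-! ### The matching gadget -/

/-- Gadget vertices: `inl (w, z, b)` = the `in` (`b = false`) / `out` (`b = true`) copy of cover node `z` inside the
`w`-th replica; `inr false` = the source absorber `g`, `inr true` = the sink absorber `g'`. [folklore] -/
abbrev GV (V : Type) : Type := (V × (V × Bool) × Bool) ⊕ Bool

/-- Constant cells: the skip edges `in_w(z) — out_w(z)`, the source edges `g — in_w(w,0)` and the sink edges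
`out_w(w,1) — g'`, for every replica `w`. [folklore] -/
def cell₀ (x y : GV V) : Prop :=
  (∃ w z, x = Sum.inl (w, z, false) ∧ y = Sum.inl (w, z, true)) ∨
    (∃ w : V, x = Sum.inr false ∧ y = Sum.inl (w, (w, false), false)) ∨
    (∃ w : V, x = Sum.inl (w, (w, true), true) ∧ y = Sum.inr true)

/-- Wire cells: inside every replica, wire `i` switches on the arcs `out(z) → in(z')` for the (one or two) cover
edges `z — z'` it carries. [folklore] -/
def cellW (p q : Fin n → V) (o : Fin n → Bool) (i : Fin n) (x y : GV V) : Prop :=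
  ∃ w z z', x = Sum.inl (w, z, true) ∧ y = Sum.inl (w, z', false) ∧ Drel p q o i z z'

/-- The **matching gadget** of the door on selection `v`: the graph spanned by the constant cells and the wire
cells of the selected wires. [folklore] -/
def gadget (p q : Fin n → V) (o : Fin n → Bool) (v : Fin n → Bool) : SimpleGraph (GV V) :=
  SimpleGraph.fromRel fun x y => cell₀ x y ∨ ∃ i, v i = true ∧ cellW p q o i x y

/-- Adjacency in the gadget, unfolded. [folklore] -/
theorem gadget_adj {v : Fin n → Bool} {x y : GV V} :
    (gadget p q o v).Adj x y ↔ x ≠ y ∧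
      ((cell₀ x y ∨ ∃ i, v i = true ∧ cellW p q o i x y) ∨
        (cell₀ y x ∨ ∃ i, v i = true ∧ cellW p q o i y x)) := by
  simp only [gadget, fromRel_adj]

/-! ### The gadget relabelled on `Fin d` (the literal shape of a TUTTE gate) -/

section Fin

variable [Fintype V] [DecidableEq V]

/-- The constant cells, transported to `Fin d`, `d = |GV V|`. [folklore] -/
def finCell₀ (V : Type) [Fintype V] [DecidableEq V] :
    Set (Fin (Fintype.card (GV V)) × Fin (Fintype.card (GV V))) :=
  {x | cell₀ ((Fintype.equivFin (GV V)).symm x.1) ((Fintype.equivFin (GV V)).symm x.2)}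

/-- The wire cells, transported to `Fin d`. [folklore] -/
def finCellW (p q : Fin n → V) (o : Fin n → Bool) (i : Fin n) :
    Set (Fin (Fintype.card (GV V)) × Fin (Fintype.card (GV V))) :=
  {x | cellW p q o i ((Fintype.equivFin (GV V)).symm x.1) ((Fintype.equivFin (GV V)).symm x.2)}

/-- The gadget in the literal shape of a TUTTE gate on `Fin d` (as in `isGRankGate_of_tutteGate`). [folklore] -/
def finGadget (p q : Fin n → V) (o : Fin n → Bool) (v : Fin n → Bool) :
    SimpleGraph (Fin (Fintype.card (GV V))) :=
  SimpleGraph.fromRel fun a b => (a, b) ∈ {x : Fin (Fintype.card (GV V)) × Fin (Fintype.card (GV V)) |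
    x ∈ finCell₀ V ∨ ∃ i, v i = true ∧ x ∈ finCellW p q o i}

/-- `finGadget` is the gadget, relabelled by `Fintype.equivFin`. [folklore] -/
noncomputable def gadgetIso (v : Fin n → Bool) : gadget p q o v ≃g finGadget p q o v where
  toEquiv := Fintype.equivFin (GV V)
  map_rel_iff' := by
    intro x y
    simp only [finGadget, finCell₀, finCellW, fromRel_adj, Set.mem_setOf_eq, Equiv.symm_apply_apply]
    rw [gadget_adj, (Fintype.equivFin (GV V)).injective.ne_iff]

omit [DecidableEq V] in
/-- The number of gadget vertices: `d = 4|V|² + 2`. [folklore] -/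
theorem card_GV : Fintype.card (GV V) = 4 * Fintype.card V ^ 2 + 2 := by
  simp only [GV, Fintype.card_sum, Fintype.card_prod, Fintype.card_bool]
  ring

end Fin

end Summit.PneNP.PneNP.Theorems.Capture.Signed
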